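import Literature.IUT.HodgeTheaters.GaloisValDatumCoveringMonoid
import Literature.IUT.HodgeArakelov.GMonoidFrobenioidsDef38Proofs
import Literature.IUT.HodgeArakelov.GMonoidFrobenioidsEquivariant
import HarnessLib

/-!
# The GENUINE `C⊢_v` covering monoid `𝒪^×_{K̄_v}·q̲^ℕ` in SPLIT FORM `U·θ^ℕ ⊆ Ω^×` (`U = 𝒪^×_{K̄_v}`, `θ = q̲`), so that
# abc-iut-w4-d019's [IUTchII] Def. 3.8 (ii) theory applies BY NAME: its model Frobenioid over `B(K_v)⁰` satisfies the
# [FrdI] Thm. 5.2 hypotheses and has divisor monoid `ℕ` AT EVERY OBJECT (B16 closer, monoid/Frobenioid-hypotheses level)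

Mochizuki, *Inter-universal Teichmüller Theory I*, kurims manuscript (May 2020), Ex. 3.2 (iv) p. 71 «`Φ_{C⊢_v} :=
ℕ·log_Φ(q̲_v)|_{D⊢_v}` … a `p_v`-adic Frobenioid», (v) p. 72 «`𝒪^▷(−) = 𝒪^×(−)·q̲_v^ℕ`» [cite: Mochizuki2012, I Ex 3.2
(iv)(v) pp.71-72]; *… II*, Def. 3.8 (ii) p. 113 «gives rise to a `p_v`-adic Frobenioid of monoid type `ℤ` … whose divisor
monoid associates to every object of `B^temp(G_v(−))⁰` a monoid isomorphic to `ℕ`» [cite: Mochizuki2012, II Def 3.8 (ii)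
p.113] (D-0012 claim key, status disputed; nothing of the series is asserted); [FrdI] Thm. 5.2 p. 100 [cite:
MochizukiFrdI2008, Thm 5.2 p.100]; [FrdII] Ex. 1.1 (i) p. 7 [cite: MochizukiFrdII2008, Ex 1.1 (i) p.7].

Cell abc-iut, seat abc-iut-L5-t2 (gen 7); row «B16-i» (δ1) (abc-iut-L6-t7 MERGE-MAP v39/v40 §B16; abc-iut-L5-lead GO
15:00:04Z (2)).  DEF-BEARING junction (3 small defs: the `G_v`-action on `Ω^×`, `θ := q̲ ∈ Ω^×`, the split covering monoid
as an `abbrev` of w4-d019's `ofStable`; + one `MulEquiv`; 0 instances / notation / `Prop` facts; nothing landed is edited).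
Consumed BY NAME: abc-iut-w4-d019's `CoveringMonoid.ofStable / splitMonoid_stable / exists_associates_invariants_equiv_nat /
hypotheses_ofStable_splitMonoid` (p455796 / p457550) and abc-iut-L6-t2's `TemperedThetaMonoids.splitMonoid`, abc-iut-L6-t7's
`CoveringMonoid.frobenioidMap` (p457393), abc-iut-L1's `PadicFrd.unitSubgroup / intNonzeroToUnits / isUnit_intNonzero_iff`,
abc-iut-L5-t2's `GaloisValDatum.galAct / dashCovering / dashAct / dashCoveringMonoid / toΩ / not_isUnit_toΩ` (p456702) and
`InitialThetaData.qRootAt` (p442528).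

WHAT THIS FILE CONSTRUCTS / PROVES (for every `d : GaloisValDatum p`, `q ∈ 𝒪^▷_{K_v}`):
* `unitsGalAct : G_v →* MulAut Ω^×` (the Galois action on the unit group of the field `Ω = K̄_v`); `unitSubgroup_stable` —
  `U := 𝒪^×_{K̄_v} = {v = 1} ≤ Ω^×` is `G_v`-STABLE (via `isUnit_galAct_iff`, p456702); `thetaUnit q := q̲ ∈ Ω^×` is
  `G_v`-FIXED (`unitsGalAct_thetaUnit`); `thetaUnit_pow_mem_unitSubgroup` — «`θ` non-torsion modulo `U`»: `q̲^n ∈ 𝒪^× ⇒ n = 0`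
  for `q̲` NOT a unit (`not_isUnit_toΩ`);
* **`dashSplitCoveringMonoid q : CoveringMonoid G_v`** := w4-d019's `ofStable unitsGalAct (U·θ^ℕ) _` — the genuine `C⊢_v`
  monoid `𝒪^×_{K̄_v}·q̲^ℕ` PRESENTED IN SPLIT FORM inside `Ω^×`;
* **`dashCoveringEquivSplit q : 𝒪^×·q̲^ℕ (p456702, inside 𝒪^▷_{K̄_v}) ≃* U·θ^ℕ (inside Ω^×)`**, `G_v`-EQUIVARIANT
  (`dashCoveringEquivSplit_dashAct`) — the two presentations agree; hence abc-iut-L6-t7's `frobenioidMap` gives the functors of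
  (A)-Frobenioids both ways (`frobenioidMapOfSplit`, `frobenioidMapToSplit`);
* BY NAME from w4-d019 (B): **`hypotheses_dashSplitCoveringMonoid`** — `ModelFrobenioid.Hypotheses` ([FrdI] Thm. 5.2: divisorial
  `Φ`, group-like `B`, base `B(K_v)⁰ = CosetCat G_v` connected + totally epimorphic) for (A)'s Frobenioid of the genuine `C⊢_v`
  monoid — «gives rise to a `p_v`-adic Frobenioid» is an honest model-Frobenioid instance; **`exists_associates_invariants_equiv_nat_dashSplit`**
  — its divisor monoid is `(ℕ, +)` AT EVERY OBJECT `G_v/V` of `D⊢_v`, `[u·q̲^n] ↦ n` = print's «`Φ_{C⊢_v} = ℕ·log_Φ(q̲_v)`»;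
* AT THE DATUM: `InitialThetaData.badSplitCoveringMonoidAt hv w p hw` (the genuine `q̲_v̲`, `Gal(K̄_w/K_w)`) with
  `hypotheses_badSplitCoveringMonoidAt` / `exists_associates_invariants_equiv_nat_badSplitCoveringMonoidAt`.
NOT DONE HERE: the equivalence of (A)'s model Frobenioid with abc-iut-L1-t4's monogenic `GaloisValDatum.dashDatum` Frobenioid
(`d.Cdash hq`, [FrdII] Ex. 1.1 (ii) data over the field functor) — a `ModelFrobenioid.DataHomOver (𝟭 _)` with bijective
components (named follow-up (δ2)).  HONEST FRAMING: constructions over typed interfaces; nothing asserts a Kummer structure or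
takes a side on [IUTchIII] Cor. 3.12; [IUTchI]/[IUTchII] disputed, nothing asserted; typed ≠ proved for anything else.
-/

noncomputable section

open scoped Classical

namespace Literature.IUT.HodgeTheaters

open CategoryTheory NumberField IsDedekindDomain Literature.AnabelianGeometry.SemiGraphs
  Literature.AlgebraicGeometry.Frobenioids Literature.AlgebraicGeometry.Frobenioids.PadicFrd
  Literature.IUT.HodgeArakelov Literature.IUT.HodgeArakelov.TemperedThetaMonoids

universe u

namespace GaloisValDatum

variable {p : ℕ} [Fact p.Prime] (d : GaloisValDatum.{u} p)

/-! ### The Galois action on `Ω^×`, the stable subgroup `𝒪^×_{K̄_v}`, the fixed element `q̲` -/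

/-- **`G_v →* Aut(Ω^×)`**: the Galois action on the unit group of `Ω = K̄_v`. [cite: Mochizuki2012, II Def 4.9 (i) p.154] -/
def unitsGalAct : d.Gal →* MulAut (d.Ω)ˣ where
  toFun σ := Units.mapEquiv (σ : d.Ω ≃ₐ[d.k] d.Ω).toMulEquiv
  map_one' := MulEquiv.ext fun _ => Units.ext rfl
  map_mul' _ _ := MulEquiv.ext fun _ => Units.ext rfl

/-- Values of `unitsGalAct` in `Ω`. [cite: Mochizuki2012, II Def 4.9 (i) p.154] -/
@[simp] theorem coe_unitsGalAct_apply (σ : d.Gal) (u : (d.Ω)ˣ) : ((d.unitsGalAct σ u : (d.Ω)ˣ) : d.Ω) = σ (u : d.Ω) := rfl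

/-- A valuation-one element of `Ω` stays valuation-one under `G_v` (units of `𝒪^▷_Ω` are preserved, p456702 `isUnit_galAct_iff`).
[cite: MochizukiFrdII2008, Ex 1.1 (i) p.7] -/
theorem valuation_gal_eq_one (σ : d.Gal) {x : d.Ω} (hx : ValuativeRel.valuation d.Ω x = 1) :
    ValuativeRel.valuation d.Ω (σ x) = 1 := by
  have hx0 : x ≠ 0 := fun h => by rw [h, map_zero] at hx; exact zero_ne_one hx
  let y : intNonzero d.Ω := ⟨x, le_of_eq hx, hx0⟩
  have hy : IsUnit y := (isUnit_intNonzero_iff d.Ω y).mpr hx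
  exact (isUnit_intNonzero_iff d.Ω (d.galAct σ y)).mp ((d.isUnit_galAct_iff σ y).mpr hy)

/-- **`U := 𝒪^×_{K̄_v} ≤ Ω^×` is `G_v`-stable.** [cite: MochizukiFrdII2008, Ex 1.1 (i) p.7] -/
theorem unitSubgroup_stable :
    ∀ (σ : d.Gal) (u : (d.Ω)ˣ), u ∈ unitSubgroup d.Ω → d.unitsGalAct σ u ∈ unitSubgroup d.Ω :=
  fun σ _ hu => (mem_unitSubgroup_iff d.Ω).mpr (d.valuation_gal_eq_one σ ((mem_unitSubgroup_iff d.Ω).mp hu))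

/-- **`θ := q̲ ∈ Ω^×`** (the image of `q ∈ 𝒪^▷_{K_v}` as a unit of the field `Ω`). [cite: Mochizuki2012, I Ex 3.2 (iv) p.71] -/
def thetaUnit (q : intNonzero d.k) : (d.Ω)ˣ := intNonzeroToUnits d.Ω (d.toΩ q)

/-- `θ = q̲` in `Ω`. [cite: Mochizuki2012, I Ex 3.2 (iv) p.71] -/
@[simp] theorem coe_thetaUnit (q : intNonzero d.k) : ((d.thetaUnit q : (d.Ω)ˣ) : d.Ω) = algebraMap d.k d.Ω q := rfl

/-- **`θ = q̲` is `G_v`-fixed** (it comes from `K_v`). [cite: Mochizuki2012, I Ex 3.2 (iv) p.71] -/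
theorem unitsGalAct_thetaUnit (q : intNonzero d.k) : ∀ σ : d.Gal, d.unitsGalAct σ (d.thetaUnit q) = d.thetaUnit q :=
  fun σ => Units.ext (σ.commutes (q : d.k))

/-- **«`θ` non-torsion modulo `U`»**: for `q̲` NOT a unit of `𝒪^▷_{K_v}`, `q̲^n ∈ 𝒪^×_{K̄_v}` forces `n = 0`.
[cite: Mochizuki2012, I Ex 3.2 (iv) p.71] -/
theorem thetaUnit_pow_mem_unitSubgroup {q : intNonzero d.k} (hq : ¬ IsUnit q) :
    ∀ n : ℕ, d.thetaUnit q ^ n ∈ unitSubgroup d.Ω → n = 0 := by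
  intro n hn
  by_contra h0
  have h1 : ValuativeRel.valuation d.Ω (((d.toΩ q ^ n : intNonzero d.Ω)) : d.Ω) = 1 := by
    rw [SubmonoidClass.coe_pow]
    have := (mem_unitSubgroup_iff d.Ω).mp hn
    rwa [Units.val_pow_eq_pow_val] at this
  have h2 : IsUnit (d.toΩ q ^ n) := (isUnit_intNonzero_iff d.Ω _).mpr h1
  exact d.not_isUnit_toΩ hq ((isUnit_pow_iff h0).mp h2)

/-! ### The split presentation `U·θ^ℕ ⊆ Ω^×` and its agreement with `𝒪^×·q̲^ℕ ⊆ 𝒪^▷_{K̄_v}` -/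

/-- **The genuine `C⊢_v` covering monoid in split form**: abc-iut-w4-d019's `ofStable` for the `G_v`-module `Ω^×`, cut out
by `U·θ^ℕ = 𝒪^×_{K̄_v}·q̲^ℕ` (abc-iut-L6-t2's `splitMonoid`). [cite: Mochizuki2012, II Def 3.8 (ii) p.113] -/
abbrev dashSplitCoveringMonoid (q : intNonzero d.k) : CoveringMonoid.{u, u} d.Gal :=
  CoveringMonoid.ofStable d.unitsGalAct (splitMonoid (unitSubgroup d.Ω) (Submonoid.powers (d.thetaUnit q)))
    (CoveringMonoid.splitMonoid_stable d.unitsGalAct _ _ d.unitSubgroup_stable (d.unitsGalAct_thetaUnit q))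

/-- An element `u·q̲^n` of `𝒪^×·q̲^ℕ ⊆ 𝒪^▷_{K̄_v}` read in `Ω^×` lies in `U·θ^ℕ`. [cite: Mochizuki2012, I Ex 3.2 (v) p.72] -/
theorem intNonzeroToUnits_mem_splitMonoid (q : intNonzero d.k) (x : d.dashCovering q) :
    intNonzeroToUnits d.Ω (x : intNonzero d.Ω) ∈ splitMonoid (unitSubgroup d.Ω) (Submonoid.powers (d.thetaUnit q)) := by
  obtain ⟨n, u, hu, hx⟩ := x.2
  refine (mem_splitMonoid_iff _ _ _).mpr ⟨intNonzeroToUnits d.Ω u, ?_, d.thetaUnit q ^ n, ⟨n, rfl⟩, ?_⟩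
  · exact (mem_unitSubgroup_iff d.Ω).mpr ((isUnit_intNonzero_iff d.Ω u).mp hu)
  · rw [hx, map_mul, map_pow]; rfl

/-- An element `u·θ^n` of `U·θ^ℕ ⊆ Ω^×` read in `Ω` lies in `𝒪^▷_{K̄_v}`. [cite: Mochizuki2012, I Ex 3.2 (v) p.72] -/
theorem coe_mem_intNonzero_of_mem_splitMonoid (q : intNonzero d.k) {y : (d.Ω)ˣ}
    (hy : y ∈ splitMonoid (unitSubgroup d.Ω) (Submonoid.powers (d.thetaUnit q))) : (y : d.Ω) ∈ intNonzero d.Ω := by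
  obtain ⟨u, hu, _, ⟨n, rfl⟩, rfl⟩ := (mem_splitMonoid_iff _ _ _).mp hy
  rw [Units.val_mul, Units.val_pow_eq_pow_val, coe_thetaUnit]
  exact (intNonzero d.Ω).mul_mem (val_mem_intNonzero_of_mem_unitSubgroup d.Ω hu)
    ((intNonzero d.Ω).pow_mem (d.toΩ q).2 n)

/-- … and in `𝒪^×·q̲^ℕ`. [cite: Mochizuki2012, I Ex 3.2 (v) p.72] -/
theorem mem_dashCovering_of_mem_splitMonoid (q : intNonzero d.k) {y : (d.Ω)ˣ}
    (hy : y ∈ splitMonoid (unitSubgroup d.Ω) (Submonoid.powers (d.thetaUnit q))) :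
    (⟨(y : d.Ω), d.coe_mem_intNonzero_of_mem_splitMonoid q hy⟩ : intNonzero d.Ω) ∈ d.dashCovering q := by
  obtain ⟨u, hu, _, ⟨n, rfl⟩, hyu⟩ := (mem_splitMonoid_iff _ _ _).mp hy
  refine ⟨n, ⟨(u : d.Ω), val_mem_intNonzero_of_mem_unitSubgroup d.Ω hu⟩, ?_, Subtype.ext ?_⟩
  · exact (isUnit_intNonzero_iff d.Ω _).mpr ((mem_unitSubgroup_iff d.Ω).mp hu)
  · change (y : d.Ω) = (u : d.Ω) * ((d.toΩ q ^ n : intNonzero d.Ω) : d.Ω)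
    rw [← hyu, Units.val_mul, Units.val_pow_eq_pow_val, SubmonoidClass.coe_pow]
    rfl

/-- **`𝒪^×·q̲^ℕ ≃* U·θ^ℕ`**: the two presentations of the genuine `C⊢_v` monoid agree (same elements of `Ω`).
[cite: Mochizuki2012, I Ex 3.2 (v) p.72] -/
def dashCoveringEquivSplit (q : intNonzero d.k) :
    ↥(d.dashCovering q) ≃* ↥(splitMonoid (unitSubgroup d.Ω) (Submonoid.powers (d.thetaUnit q))) where
  toFun x := ⟨intNonzeroToUnits d.Ω (x : intNonzero d.Ω), d.intNonzeroToUnits_mem_splitMonoid q x⟩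
  invFun y := ⟨⟨(y.1 : d.Ω), d.coe_mem_intNonzero_of_mem_splitMonoid q y.2⟩, d.mem_dashCovering_of_mem_splitMonoid q y.2⟩
  left_inv _ := Subtype.ext (Subtype.ext rfl)
  right_inv _ := Subtype.ext (Units.ext rfl)
  map_mul' _ _ := Subtype.ext (map_mul (intNonzeroToUnits d.Ω) _ _)

/-- Values in `Ω`: `dashCoveringEquivSplit` does not move elements. [cite: Mochizuki2012, I Ex 3.2 (v) p.72] -/
@[simp] theorem coe_coe_dashCoveringEquivSplit (q : intNonzero d.k) (x : d.dashCovering q) :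
    (((d.dashCoveringEquivSplit q x).1 : (d.Ω)ˣ) : d.Ω) = ((x : intNonzero d.Ω) : d.Ω) := rfl

/-- **`G_v`-EQUIVARIANCE** of `dashCoveringEquivSplit` (both actions are `σ` on elements of `Ω`).
[cite: Mochizuki2012, II Def 3.8 (ii) p.113] -/
theorem dashCoveringEquivSplit_dashAct (q : intNonzero d.k) (σ : d.Gal) (x : d.dashCovering q) :
    d.dashCoveringEquivSplit q (d.dashAct q σ x) = (d.dashSplitCoveringMonoid q).act σ (d.dashCoveringEquivSplit q x) :=
  Subtype.ext (Units.ext rfl)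

/-- The inverse direction of the equivariance. [cite: Mochizuki2012, II Def 3.8 (ii) p.113] -/
theorem dashCoveringEquivSplit_symm_act (q : intNonzero d.k) (σ : d.Gal)
    (y : splitMonoid (unitSubgroup d.Ω) (Submonoid.powers (d.thetaUnit q))) :
    (d.dashCoveringEquivSplit q).symm ((d.dashSplitCoveringMonoid q).act σ y) =
      d.dashAct q σ ((d.dashCoveringEquivSplit q).symm y) :=
  Subtype.ext (Subtype.ext rfl)

/-- **The functor of (A)-Frobenioids `F(𝒪^×·q̲^ℕ) ⥤ F(U·θ^ℕ)`** induced by the equivariant isomorphism (abc-iut-L6-t7's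
`frobenioidMap`, [IUTchII] Def. 3.8 (i) «may be interpreted as an isomorphism of Frobenioids»). [cite: Mochizuki2012, II Def 3.8 (i) p.113] -/
abbrev frobenioidMapToSplit (q : intNonzero d.k) :
    (d.dashCoveringMonoid q).frobenioid ⥤ (d.dashSplitCoveringMonoid q).frobenioid :=
  CoveringMonoid.frobenioidMap (M := d.dashCoveringMonoid q) (M' := d.dashSplitCoveringMonoid q)
    (d.dashCoveringEquivSplit q).toMonoidHom (d.dashCoveringEquivSplit_dashAct q)

/-- **… and back `F(U·θ^ℕ) ⥤ F(𝒪^×·q̲^ℕ)`.** [cite: Mochizuki2012, II Def 3.8 (i) p.113] -/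
abbrev frobenioidMapOfSplit (q : intNonzero d.k) :
    (d.dashSplitCoveringMonoid q).frobenioid ⥤ (d.dashCoveringMonoid q).frobenioid :=
  CoveringMonoid.frobenioidMap (M := d.dashSplitCoveringMonoid q) (M' := d.dashCoveringMonoid q)
    (d.dashCoveringEquivSplit q).symm.toMonoidHom (d.dashCoveringEquivSplit_symm_act q)

/-! ### By name from abc-iut-w4-d019 (B): [FrdI] Thm. 5.2 hypotheses and «divisor monoid ≅ ℕ at every object» -/

/-- **«gives rise to a `p_v`-adic Frobenioid» is an honest [FrdI] Thm. 5.2 instance for the GENUINE `C⊢_v` monoid**: (A)'s data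
`(Φ, B) = (Ψ/Ψ^×, Ψ^gp)` over `B(K_v)⁰ = CosetCat G_v` satisfy `ModelFrobenioid.Hypotheses` (w4-d019's
`hypotheses_ofStable_splitMonoid` BY NAME, at `U = 𝒪^×_{K̄_v}`, `θ = q̲`). [cite: Mochizuki2012, II Def 3.8 (ii) p.113] -/
theorem hypotheses_dashSplitCoveringMonoid {q : intNonzero d.k} (hq : ¬ IsUnit q) :
    ModelFrobenioid.Hypotheses (d.dashSplitCoveringMonoid q).divisorFunctor (d.dashSplitCoveringMonoid q).ratFnFunctor :=
  CoveringMonoid.hypotheses_ofStable_splitMonoid d.unitsGalAct (unitSubgroup d.Ω) (d.thetaUnit q)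
    d.unitSubgroup_stable (d.unitsGalAct_thetaUnit q) (d.thetaUnit_pow_mem_unitSubgroup hq)

/-- **«whose divisor monoid associates to EVERY object … a monoid isomorphic to `ℕ`» for the GENUINE `C⊢_v` monoid**: at
every object `G_v/V` of `D⊢_v` the divisor monoid `Ψ^V/(Ψ^V)^×` of (A)'s Frobenioid is `(ℕ, +)`, `[u·q̲^n] ↦ n` — print's
«`Φ_{C⊢_v} = ℕ·log_Φ(q̲_v)|_{D⊢_v}`» (w4-d019's `exists_associates_invariants_equiv_nat` BY NAME).
[cite: Mochizuki2012, I Ex 3.2 (iv) p.71] -/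
theorem exists_associates_invariants_equiv_nat_dashSplit {q : intNonzero d.k} (hq : ¬ IsUnit q) (V : Subgroup d.Gal) :
    ∃ e : Associates ((d.dashSplitCoveringMonoid q).invariants V) ≃* Multiplicative ℕ,
      ∀ (x : (d.dashSplitCoveringMonoid q).invariants V) (u : (d.Ω)ˣ) (n : ℕ), u ∈ unitSubgroup d.Ω →
        ((x : splitMonoid (unitSubgroup d.Ω) (Submonoid.powers (d.thetaUnit q))) : (d.Ω)ˣ) = u * d.thetaUnit q ^ n →
        e (Associates.mk x) = Multiplicative.ofAdd n :=
  CoveringMonoid.exists_associates_invariants_equiv_nat d.unitsGalAct (unitSubgroup d.Ω) (d.thetaUnit q)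
    d.unitSubgroup_stable (d.unitsGalAct_thetaUnit q) (d.thetaUnit_pow_mem_unitSubgroup hq) V

end GaloisValDatum

/-! ### At the genuine datum -/

namespace InitialThetaData

variable {F K Fbar : Type} [Field F] [NumberField F] [Field K] [NumberField K] [Algebra F K]
  [Field Fbar] [Algebra F Fbar] [Algebra K Fbar] [IsScalarTower F K Fbar] {E : WeierstrassCurve F}
  [E.IsElliptic] {l : ℕ} {Pb : BadPlacePredicates K} (D : InitialThetaData F K Fbar E l Pb)
  {v : FinitePlace F} (hv : v ∈ D.VFbad) (w : HeightOneSpectrum (𝓞 K)) [w.asIdeal.LiesOver v.maximalIdeal.asIdeal]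
  (p : ℕ) [Fact p.Prime] (hw : ((p : ℕ) : 𝓞 K) ∈ w.asIdeal)

/-- **The GENUINE `C⊢_v̲` monoid in split form** `𝒪^×_{K̄_w}·q̲_v̲^ℕ ⊆ K̄_w^×` with its `Gal(K̄_w/K_w)`-action, for initial Θ-data
`D` at `v̲ = w ∣ v ∈ V(F)^bad` (`q̲_v̲` = the genuine `2l`-th root of the Tate parameter). [cite: Mochizuki2012, I Ex 3.2 (iv) p.71] -/
abbrev badSplitCoveringMonoidAt : CoveringMonoid.{0, 0} (GaloisValDatum.ofPlace K p w hw).Gal :=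
  (GaloisValDatum.ofPlace K p w hw).dashSplitCoveringMonoid (D.qRootAt hv w p hw)

/-- Its (A)-Frobenioid data satisfy the [FrdI] Thm. 5.2 hypotheses. [claim: Mochizuki2012, status: disputed] -/
theorem hypotheses_badSplitCoveringMonoidAt :
    ModelFrobenioid.Hypotheses (D.badSplitCoveringMonoidAt hv w p hw).divisorFunctor
      (D.badSplitCoveringMonoidAt hv w p hw).ratFnFunctor :=
  GaloisValDatum.hypotheses_dashSplitCoveringMonoid _ (D.qRootAt_not_isUnit hv w p hw)

/-- **Its divisor monoid is `ℕ` at EVERY object of `D⊢_v̲ = B(K_v̲)⁰`** («`Φ_{C⊢_v} ≅ ℕ·log_Φ(q̲_v)`»).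
[claim: Mochizuki2012, status: disputed] -/
theorem exists_associates_invariants_equiv_nat_badSplitCoveringMonoidAt (V : Subgroup (GaloisValDatum.ofPlace K p w hw).Gal) :
    ∃ e : Associates ((D.badSplitCoveringMonoidAt hv w p hw).invariants V) ≃* Multiplicative ℕ,
      ∀ (x : (D.badSplitCoveringMonoidAt hv w p hw).invariants V) (u : ((GaloisValDatum.ofPlace K p w hw).Ω)ˣ) (n : ℕ),
        u ∈ unitSubgroup (GaloisValDatum.ofPlace K p w hw).Ω →
        ((x : splitMonoid (unitSubgroup (GaloisValDatum.ofPlace K p w hw).Ω)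
            (Submonoid.powers ((GaloisValDatum.ofPlace K p w hw).thetaUnit (D.qRootAt hv w p hw)))) :
          ((GaloisValDatum.ofPlace K p w hw).Ω)ˣ) =
          u * (GaloisValDatum.ofPlace K p w hw).thetaUnit (D.qRootAt hv w p hw) ^ n →
        e (Associates.mk x) = Multiplicative.ofAdd n :=
  GaloisValDatum.exists_associates_invariants_equiv_nat_dashSplit _ (D.qRootAt_not_isUnit hv w p hw) V

end InitialThetaData

end Literature.IUT.HodgeTheaters

end
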